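import Literature.NumberTheory.EllipticCurves.SelmerCorankControlRatOrdinaryLayerKummerCountProofs
import Literature.NumberTheory.EllipticCurves.CyclotomicZpExtensionLayerUniformizerProofs
import HarnessLib

/-!
# Greenberg's Lemma 3.4 at EVERY layer of the cyclotomic `ℤ_p`-extension of `ℚ`, for EVERY prime `p` of good
# ordinary reduction

`Proofs` file (theorems only: **no definition, no named fact, nothing asserted**) in topic `NumberTheory/EllipticCurves`,
sequel of `SelmerCorankControlRatOrdinaryLayerKummerCountProofs` (Lemma 3.4 at the layer `n` for every `p`, given an
`H_{v,n}`-fixed `π` with `|π|^d = |p|`, `pⁿ ∣ d`; and `p = 2` unconditionally with `π_n = 2 - (ζ + ζ⁻¹)`). For ODD `p` the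
uniformiser of `(ℚ_n)_p` is `π_n = N_{ℚ(ζ_{p^{n+1}})/ℚ_n}(1 - ζ) = ∏_{b ∈ Δ} (1 - ζ^b)`, `Δ = {b : b^{p-1} = 1} ≤ (ℤ/p^{n+1})^×`
(`CyclotomicZpExtensionLayerUniformizerProofs`: `π_n ∈ ℚ_n`, `#Δ = p - 1`). R. Greenberg, LNM 1716 (1999), §3 Lemma 3.4
(p. 89); L. C. Washington, *Cyclotomic Fields*, §13.1, Lemma 1.4.

* `spectralValuation_prod_one_sub_pow_pow_eq` — **`|∏_{b ∈ Δ} (1 - ζ^b)|^{pⁿ} = |p|`** in `K̄_v` for a primitive `p^{n+1}`-th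
  root of unity `ζ` (`p` odd): each `ζ^b` is primitive, `|1 - ζ^b|^{(p-1)pⁿ} = |p|`
  (`spectralValuation_one_sub_pow_totient_eq`), and `#Δ = p - 1`.
* `WeierstrassCurve.finite_localTowerKerPrimary_of_ordinary_odd` — **Lemma 3.4 at every layer `n`, `p` odd, unconditional**.
* `WeierstrassCurve.finite_localTowerKerPrimary_of_ordinary` — **every prime `p`** (with the `p = 2` case of the parent file).

HONEST FRAMING (cell `bsd-f1-sign2`, WIDTH-5 attach seat `bsd-line-att-p5` g42 on crux stmt-BirchSwinnertonDyer-22298):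
COROLLARY-OF-PRINT (an elementary proof of Greenberg's Lemma 3.4, finiteness clause, for the cyclotomic tower over `ℚ` at
every layer and every good ordinary `p`); the named fact `Greenberg1999.lemma34_natCard_localTowerKerPrimary_eq_rat` (exact
cardinality) is NOT discharged; closes no item; BSD is not proved by any of this.

## References

* [GreenbergLNM1716] R. Greenberg, LNM 1716 (1999), §3 Lemma 3.4 (p. 89), §2 Prop. 2.2 (p. 73).
* [Washington1997] L. C. Washington, *Introduction to Cyclotomic Fields*, §13.1, Lemma 1.4.

## Design

No definitions; `noncomputable section`; one universe `u`. Axioms: `propext`, `Classical.choice`, `Quot.sound`.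
-/

noncomputable section

open scoped Classical NNReal
open NumberField IsDedekindDomain

universe u

/-! ## §1 `|π_n|^{pⁿ} = |p|` -/

namespace IsDedekindDomain.HeightOneSpectrum

open Literature.NumberTheory.EllipticCurves Literature.NumberTheory.GaloisRepresentations Field

variable {K : Type u} [Field K] [NumberField K] {v : HeightOneSpectrum (𝓞 K)} {p : ℕ} [hp : Fact p.Prime]
  {w : Valuation (AlgebraicClosure (v.adicCompletion K)) ℝ≥0}

/-- **`|∏_{b ∈ Δ} (1 - ζ^b)|^{pⁿ} = |p|`** for a primitive `p^{n+1}`-th root of unity `ζ ∈ K̄_v`, `p` odd,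
`Δ = {b ∈ (ℤ/p^{n+1})^× : b^{p-1} = 1}`: every `ζ^b` (`b` a unit) is again primitive, so `|1 - ζ^b|^{φ(p^{n+1})} = |p|`
(`spectralValuation_one_sub_pow_totient_eq`, Washington Lemma 1.4), `φ(p^{n+1}) = (p-1)pⁿ`, and `#Δ = p - 1`
(`ZpExtension.card_filter_pow_sub_one_eq_one`); take `(p-1)`-th roots in `ℝ≥0`. This is "`π_n = N(1 - ζ_{p^{n+1}})` is a
uniformiser of the totally ramified `(ℚ_n)_p`, `e = pⁿ`". [cite: Washington1997, Lemma 1.4] -/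
theorem spectralValuation_prod_one_sub_pow_pow_eq (hp2 : p ≠ 2) {n : ℕ} [NeZero (p ^ (n + 1))]
    {ζ : AlgebraicClosure (v.adicCompletion K)} (hζ : IsPrimitiveRoot ζ (p ^ (n + 1))) :
    w (∏ b ∈ Finset.univ.filter (fun b : (ZMod (p ^ (n + 1)))ˣ ↦ b ^ (p - 1) = 1),
        (1 - ζ ^ ((b : ZMod (p ^ (n + 1)))).val)) ^ p ^ n =
      w (p : AlgebraicClosure (v.adicCompletion K)) := by
  have hpp := hp.out
  set Δ : Finset (ZMod (p ^ (n + 1)))ˣ := Finset.univ.filter (fun b : (ZMod (p ^ (n + 1)))ˣ ↦ b ^ (p - 1) = 1)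
    with hΔdef
  have hcard : Δ.card = p - 1 := ZpExtension.card_filter_pow_sub_one_eq_one hp2 n
  have htot : Nat.totient (p ^ (n + 1)) = p ^ n * (p - 1) := by
    rw [Nat.totient_prime_pow hpp (Nat.succ_pos n)]; simp
  -- each factor: `|1 - ζ^b|^{φ} = |p|`
  have hfac : ∀ b ∈ Δ, w (1 - ζ ^ ((b : ZMod (p ^ (n + 1)))).val) ^ (p ^ n * (p - 1)) =
      w (p : AlgebraicClosure (v.adicCompletion K)) := by
    intro b _
    have hb : IsPrimitiveRoot (ζ ^ ((b : ZMod (p ^ (n + 1)))).val) (p ^ (n + 1)) :=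
      hζ.pow_of_coprime _ (ZMod.val_coe_unit_coprime b)
    rw [← htot]
    exact spectralValuation_one_sub_pow_totient_eq hb
  -- the product
  have hprod : (w (∏ b ∈ Δ, (1 - ζ ^ ((b : ZMod (p ^ (n + 1)))).val)) ^ p ^ n) ^ (p - 1) =
      w (p : AlgebraicClosure (v.adicCompletion K)) ^ (p - 1) := by
    rw [map_prod, ← pow_mul, ← Finset.prod_pow, Finset.prod_congr rfl hfac, Finset.prod_const, hcard]
  have hp1 : p - 1 ≠ 0 := by have := hpp.two_le; omega
  exact pow_left_injective hp1 hprod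

end IsDedekindDomain.HeightOneSpectrum

/-! ## §2 Lemma 3.4 at every layer, `p` odd; then every `p` -/

namespace WeierstrassCurve

open Literature.NumberTheory.EllipticCurves Literature.NumberTheory.GaloisRepresentations Field
  IsDedekindDomain.HeightOneSpectrum Literature.NumberTheory.EllipticCurves.FormalGroupChart

variable (W : WeierstrassCurve ℚ) [W.IsGloballyMinimal] [W.IsElliptic] {p : ℕ} [hp : Fact p.Prime]
  {v : HeightOneSpectrum (𝓞 ℚ)}

/-- **Greenberg's Lemma 3.4 at EVERY layer `n` of the cyclotomic `ℤ_p`-extension of `ℚ`, `p` ODD, for `E/ℚ` good ordinary at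
`p` — unconditionally.** For a globally minimal `W/ℚ` with `p ∤ Δ_W`, `p ∤ a_p`, the cyclotomic `ℤ_p`-extension `κ`, `v ∋ p` and
any `n`, `𝒦_{v,n}[p^∞] = W.localTowerKerPrimary κ ℚ_v n` is finite. The uniformiser of `(ℚ_n)_p` is
`π_n = ∏_{b ∈ Δ} (1 - ζ^b)` for a primitive `p^{n+1}`-th root of unity `ζ ∈ ℚ̄` (`π_n ∈ ℚ_n`,
`ZpExtension.IsCyclotomic.prod_one_sub_pow_mem_layer`), whose image in `K̄_v` is fixed by `H_{v,n}` and has `|π_n|^{pⁿ} = |p|`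
(§1); apply `finite_localTowerKerPrimary_of_ordinary_of_uniformizer` with `d = pⁿ` on the spectral valuation of the tree and the
integral model `W_ℤ ⊗ 𝒪_w`. [cite: GreenbergLNM1716, §3 Lemma 3.4 (p. 89)] [cite: Washington1997, §13.1] -/
theorem finite_localTowerKerPrimary_of_ordinary_odd (hp2 : p ≠ 2) (hpv : (p : 𝓞 ℚ) ∈ v.asIdeal)
    (hΔ : ¬ (p : ℤ) ∣ minimalDiscriminantInt W) (hord : ¬ (p : ℤ) ∣ W.frobeniusTrace p)
    (κ : ZpExtension ℚ p) (hκ : κ.IsCyclotomic) (n : ℕ) :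
    Finite (W.localTowerKerPrimary κ (v.adicCompletion ℚ) n) := by
  obtain ⟨w, hw⟩ := v.exists_spectralValuation
  haveI hV : (W.baseChange (AlgebraicClosure (v.adicCompletion ℚ))).IsIntegral w.integer :=
    ⟨⟨(integralModelInt W).map (algebraMap ℤ ↥w.integer),
      W.baseChange_eq_localIntModel_integer_baseChange⟩⟩
  haveI : NeZero (p ^ (n + 1) : ℕ) := ⟨pow_ne_zero _ hp.out.ne_zero⟩
  -- a primitive `p^{n+1}`-th root of unity in `ℚ̄` and `θ = ∏_{b ∈ Δ} (1 - ζ^b) ∈ ℚ_n`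
  obtain ⟨ζ, hζ⟩ := HasEnoughRootsOfUnity.exists_primitiveRoot (AlgebraicClosure ℚ) (p ^ (n + 1))
  set θ : AlgebraicClosure ℚ := ∏ b ∈ Finset.univ.filter (fun b : (ZMod (p ^ (n + 1)))ˣ ↦ b ^ (p - 1) = 1),
    (1 - ζ ^ ((b : ZMod (p ^ (n + 1)))).val) with hθdef
  have hθ : θ ∈ κ.layer n := ZpExtension.IsCyclotomic.prod_one_sub_pow_mem_layer hκ hp2 n hζ.pow_eq_one
  have hθfix : ∀ σ' ∈ κ.layerSubgroup n, (absoluteGaloisGroup.toAlgEquiv ℚ σ') θ = θ := by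
    intro σ' hσ'
    have hmem := hθ
    change θ ∈ IntermediateField.fixedField _ at hmem
    rw [IntermediateField.mem_fixedField_iff] at hmem
    exact hmem _ ⟨σ', hσ', rfl⟩
  -- `π = ι θ`
  let ι := closureEmb (K := ℚ) (v.adicCompletion ℚ)
  let π : AlgebraicClosure (v.adicCompletion ℚ) := ι θ
  have hπH : ∀ σ ∈ localSubgroup (κ.layerSubgroup n) (v.adicCompletion ℚ), σ • π = π := by
    intro σ hσ
    rw [mem_localSubgroup_iff] at hσ
    have h := apply_resGalAuxOfEmb_apply (closureEmb (K := ℚ) (v.adicCompletion ℚ)) σ θ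
    have hfix := hθfix _ hσ
    change closureEmb (K := ℚ) (v.adicCompletion ℚ)
      ((absoluteGaloisGroup.toAlgEquiv ℚ (resGal (K := ℚ) (v.adicCompletion ℚ) σ)) θ) = σ • π at h
    rw [hfix] at h
    exact h.symm
  have hζ' : IsPrimitiveRoot (ι ζ) (p ^ (n + 1)) := hζ.map_of_injective ι.injective
  have hπ : w π ^ p ^ n = w (p : AlgebraicClosure (v.adicCompletion ℚ)) := by
    have e : π = ∏ b ∈ Finset.univ.filter (fun b : (ZMod (p ^ (n + 1)))ˣ ↦ b ^ (p - 1) = 1),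
        (1 - (ι ζ) ^ ((b : ZMod (p ^ (n + 1)))).val) := by
      change ι θ = _
      rw [hθdef, map_prod]
      exact Finset.prod_congr rfl fun b _ ↦ by rw [map_sub, map_one, map_pow]
    rw [e]
    exact spectralValuation_prod_one_sub_pow_pow_eq hp2 hζ'
  exact W.finite_localTowerKerPrimary_of_ordinary_of_uniformizer hw hpv hΔ hord κ hκ n (d := p ^ n) dvd_rfl hπH hπ

/-- **Greenberg's Lemma 3.4 at EVERY layer `n` of the cyclotomic `ℤ_p`-extension of `ℚ` for EVERY prime `p` of good ordinary
reduction — unconditionally** (globally minimal `W/ℚ`, `p ∤ Δ_W`, `p ∤ a_p`, `κ` cyclotomic, `v ∋ p`): the `p = 2` case is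
`finite_localTowerKerPrimary_of_ordinary_two` (`π_n = 2 - (ζ + ζ⁻¹)`), the odd case `finite_localTowerKerPrimary_of_ordinary_odd`
(`π_n = N(1 - ζ_{p^{n+1}})`). Greenberg, LNM 1716, §3 Lemma 3.4 (p. 89): for `v ∣ p` good ordinary and the cyclotomic
`ℤ_p`-extension, `ker(H¹((F_n)_v, E)[p^∞] → H¹((F_∞)_η, E))` is finite (there with the exact order `#Ẽ(𝔽_p)(p)²`, not claimed
here). [cite: GreenbergLNM1716, §3 Lemma 3.4 (p. 89)] -/
theorem finite_localTowerKerPrimary_of_ordinary (hpv : (p : 𝓞 ℚ) ∈ v.asIdeal)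
    (hΔ : ¬ (p : ℤ) ∣ minimalDiscriminantInt W) (hord : ¬ (p : ℤ) ∣ W.frobeniusTrace p)
    (κ : ZpExtension ℚ p) (hκ : κ.IsCyclotomic) (n : ℕ) :
    Finite (W.localTowerKerPrimary κ (v.adicCompletion ℚ) n) := by
  rcases eq_or_ne p 2 with rfl | hp2
  · exact W.finite_localTowerKerPrimary_of_ordinary_two hpv hΔ hord κ hκ n
  · exact W.finite_localTowerKerPrimary_of_ordinary_odd hp2 hpv hΔ hord κ hκ n

end WeierstrassCurve
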